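import Summits.CriticalPhenomena.SAWScalingLimit.Theorems.SAWCompassLatticeSurfaceUniversalityTollReduction
import Summits.CriticalPhenomena.SAWScalingLimit.Theorems.SAWCompassLatticeCompassSLEIffYBSquareSLE

/-!
# `SurfaceUniversality` (stmt-CriticalPhenomena-6964) is, inside its own route, the summit conjunct

Lead c2 of the line `registered` (crux `Summit.CriticalPhenomena.SAWScalingLimit.Theses.SAWCompassLattice.SurfaceUniversality`,
route `SAWCompassLattice`; `--supports stmt-CriticalPhenomena-6964`). The sibling crux `YBtoUniform`
(stmt-16966) was shown summit-equivalent inside ITS route by its strategist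
(`Cruxes/YBtoUniform/SummitEquivalent.lean`); this file records the same kernel-checked fact for 6964,
sorry-free, so planners read it off the tree rather than off a census:

* `surfaceUniversality_of_compassSLE_of_sawScalingLimit` — **the summit pays the crux**:
  `CompassSLE → SAWScalingLimit → SurfaceUniversality` (the compass chordal law and the critical `ℤ²` law
  both converge to chordal SLE(8/3) curves of one Dobrushin domain, and SLE(8/3) in `D` is ONE law:
  `Toll.tendsto_sub_of_sle`); with the landed `compassSLE_of_ybSquareSLE` also
  `YBSquareSLE → SAWScalingLimit → SurfaceUniversality`.
* `surfaceUniversality_iff_sawScalingLimit` — **given `YBSquareSLE` (stmt-6967, equivalently `CompassSLE`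
  stmt-6965 by the landed `compassSLE_iff_ybSquareSLE`), the crux `SurfaceUniversality` is EQUIVALENT to the
  sub-problem statement `SAWScalingLimit`** (`→` is the landed
  `Sketch.sawScalingLimit_of_ybSquareSLE_of_surfaceUniversality`).
* `surfaceUniversality_iff_sawScalingLimit_in_route` — the in-route form through the deciding theorem
  `SAWCompassLattice.closes`: `CompassRealisation → CompassEndpoints → CompassSLE →
  (SurfaceUniversality ↔ SAWScalingLimit)`.

Reading: any line for this crux that uses the route's context "the compass / Yang–Baxter side converges"
is a proof of `SAWScalingLimit`; any line that does not compares the two finite-mesh laws directly —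
the registered line `Lines/birth.lean` (v6: tightness 1881 + `LipApproxIndependence` + the kernel
`LipUnifToYB`). Nothing here is specific to SLE beyond uniqueness in law; no new hypothesis is introduced.
-/

noncomputable section

namespace Summit.CriticalPhenomena.SAWScalingLimit.Theorems.SurfaceUniversality.SummitEquivalent

open MeasureTheory Filter Topology Set
open scoped NNReal ENNReal
open Literature.Probability.RandomPlanarGeometry
open Literature.Probability.RandomPlanarGeometry.SAW
open Literature.Probability.RandomPlanarGeometry.SAW.YangBaxter
open Summit.CriticalPhenomena.SAWScalingLimit.Theses
open Summit.CriticalPhenomena.SAWScalingLimit.Theses.SAWCompassLattice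
open Summit.CriticalPhenomena.SAWScalingLimit.Cruxes.HexTransfer (Sketch.sawScalingLimit_of_ybSquareSLE_of_surfaceUniversality)
open Summit.CriticalPhenomena.SAWScalingLimit.Theorems.SAWCompassLatticeCompassSLE (compassSLE_of_ybSquareSLE
  ybSquareSLE_of_compassSLE)

/-- **The summit pays the crux.** If the compass chordal law converges to chordal SLE(8/3)
(`CompassSLE`, stmt-6965) and the critical `δℤ²` SAW does too (`SAWScalingLimit`, the sub-problem
statement), then the two finite-mesh laws merge on every bounded continuous test function, for every
compass solution, Dobrushin domain and pair of endpoint approximations: both converge to SLE(8/3) curves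
of `D`, and SLE(8/3) in `D` is one law (`Toll.tendsto_sub_of_sle`). [folklore] -/
theorem surfaceUniversality_of_compassSLE_of_sawScalingLimit (hC : CompassSLE)
    (hS : _root_.SAWScalingLimit) : SurfaceUniversality := by
  refine Cruxes.HexTransfer.Sketch.Surface.surfaceUniversality_iff.2 ?_
  intro α β s z hsol D a b a' b' hab hab' f
  obtain ⟨Γ₁, hΓ₁, -, hT₁⟩ := hS D a b hab
  obtain ⟨Γ₂, hΓ₂, -, hT₂⟩ := hC α β s z hsol D a' b' hab'
  exact Toll.tendsto_sub_of_sle hΓ₁ hΓ₂ hT₁ hT₂ f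

/-- `YBSquareSLE` (stmt-6967) and the summit conjunct give the crux (through the landed
`compassSLE_of_ybSquareSLE`: port dictionary + `O(δ)` port transfer). [folklore] -/
theorem surfaceUniversality_of_ybSquareSLE_of_sawScalingLimit (hY : YBSquareSLE)
    (hS : _root_.SAWScalingLimit) : SurfaceUniversality :=
  surfaceUniversality_of_compassSLE_of_sawScalingLimit (compassSLE_of_ybSquareSLE hY) hS

/-- **Given `YBSquareSLE`, the crux is the summit**: `SurfaceUniversality ↔ SAWScalingLimit`
(`→`: the landed `Sketch.sawScalingLimit_of_ybSquareSLE_of_surfaceUniversality`;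
`←`: `surfaceUniversality_of_ybSquareSLE_of_sawScalingLimit`). [folklore] -/
theorem surfaceUniversality_iff_sawScalingLimit (hY : YBSquareSLE) :
    SurfaceUniversality ↔ _root_.SAWScalingLimit :=
  ⟨Sketch.sawScalingLimit_of_ybSquareSLE_of_surfaceUniversality hY,
    surfaceUniversality_of_ybSquareSLE_of_sawScalingLimit hY⟩

/-- **In-route form**: given the three other open-or-closed cruxes of route `SAWCompassLattice`
(`CompassRealisation`, `CompassEndpoints`, `CompassSLE`), its crux `SurfaceUniversality` is EQUIVALENT to
the sub-problem statement `SAWScalingLimit` (`→` is the deciding theorem `SAWCompassLattice.closes`).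
[folklore] -/
theorem surfaceUniversality_iff_sawScalingLimit_in_route (hR : CompassRealisation)
    (hE : CompassEndpoints) (hC : CompassSLE) : SurfaceUniversality ↔ _root_.SAWScalingLimit :=
  ⟨SAWCompassLattice.closes hR hE hC, surfaceUniversality_of_compassSLE_of_sawScalingLimit hC⟩

/-! ### Registered stub of stmt-CriticalPhenomena-6964 (one-line signature, proved verbatim) -/

/-- Registered stub `surfaceUniversality_iff_sawScalingLimit_of_compassSLE`: given `CompassSLE`, the
crux `SurfaceUniversality` is the summit conjunct. [folklore] -/
theorem surfaceUniversality_iff_sawScalingLimit_of_compassSLE : SAWCompassLattice.CompassSLE → (SAWCompassLattice.SurfaceUniversality ↔ _root_.SAWScalingLimit) :=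
  fun hC => surfaceUniversality_iff_sawScalingLimit (ybSquareSLE_of_compassSLE hC)

end Summit.CriticalPhenomena.SAWScalingLimit.Theorems.SurfaceUniversality.SummitEquivalent

end
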